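import Summits.CriticalPhenomena.Ising3DConformalLimit.Theses.BernsteinTemperature
import Summits.CriticalPhenomena.Ising3DConformalLimit.Theorems.PrecisionLaplacianMoebiusLimitOfTwoPointLawBareFactorisation
import Summits.CriticalPhenomena.Ising3DConformalLimit.Theorems.GaussianScaleMixtureRotationUpgradeFromTwoPoint
import HarnessLib

/-!
# Strategist census sketch for crux `MoebiusLimitOfTwoPointLaw` (stmt-CriticalPhenomena-4801) — signatures only

`S⁺` of the STRENGTHEN heading (model-free "scale + reflection positivity ⇒ conformal" inside the Ising window
`1/2 < Δ ≤ 1`), the sphere-RP variant, and the DECOMPOSITION actually filed (children = items 4738, 1982; glue and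
exactness are landed theorems).  Nothing here is proposed to the tree.
-/

noncomputable section

namespace Summit.CriticalPhenomena.Ising3DConformalLimit.Cruxes.MoebiusLimitOfTwoPointLaw.StrategistCensus

open Literature.Probability.LatticeModels Filter Topology
open Summit.CriticalPhenomena.Ising3DConformalLimit.Theses

/-- Osterwalder–Schrader positivity of all orders across EVERY affine plane `{⟪x - p, n⟫ = 0}` (the conclusion
shape of the landed `stub_nineMirrorRP`, for all unit normals and base points). -/
def AllPlaneRP (S : CorrFamily 3) : Prop :=
  ∀ (n p : EuclideanSpace ℝ (Fin 3)), ‖n‖ = 1 →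
    ∀ (k : ℕ) (m : Fin k → ℕ) (A : (a : Fin k) → Fin (m a) → EuclideanSpace ℝ (Fin 3)) (c : Fin k → ℝ),
      (∀ a i, 0 < inner ℝ (A a i - p) n) →
      0 ≤ ∑ a, ∑ b, c a * c b *
        S (m a + m b) (Fin.append (fun i => p + ((ℝ ∙ n)ᗮ).reflection (A a i - p)) (A b))

/-- **S⁺ (STRENGTHEN heading).** Model-free strengthening of the conformal half (item 1982) inside the Ising
window: every normalised, non-degenerate, Euclidean-invariant, scale-covariant (`1/2 < Δ ≤ 1`), all-plane
reflection-positive, continuous-off-the-diagonals family on `ℝ³` is unit-inversion covariant.  This is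
"scale + unitarity ⇒ conformal" for one scalar of low dimension in `d = 3`: OPEN both ways (no proof; no
reflection-positive counterexample is known — every known interacting scale-without-conformal fixed point
has a shift symmetry and is non-unitary, Gimenez-Grau–Nakayama–Rychkov 2024 §5; RP scalar descendants need
weight `≥ 5/2`).  It DROPS the lattice: a generalisation, not a rigidification. -/
def ScaleToConformalRP : Prop :=
  ∀ (Δ : ℝ) (S : CorrFamily 3), 1/2 < Δ → Δ ≤ 1 →
    (∀ n z, z ∉ NonCoincident 3 n → S n z = 0) → IsNondegenerateTwoPoint S →
    IsEuclideanInvariant S → IsScaleCovariant Δ S → AllPlaneRP S →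
    (∀ n, ContinuousOn (S n) (NonCoincident 3 n)) → IsInversionCovariant Δ S

/-- **Sphere reflection "positivity" (TRANSFER heading, the object the 8367 engine lacks).** Positivity of the
Gram sums across the unit sphere with the conformal weight `‖x‖^{-2Δ}`.  By polarisation the reality/Hermitian
part of this condition already CONTAINS unit-inversion covariance of `S`, so it is not a weaker interface. -/
def SphereRP (Δ : ℝ) (S : CorrFamily 3) : Prop :=
  ∀ (k : ℕ) (m : Fin k → ℕ) (A : (a : Fin k) → Fin (m a) → EuclideanSpace ℝ (Fin 3)) (c : Fin k → ℝ),
    (∀ a i, 0 < ‖A a i‖ ∧ ‖A a i‖ < 1) →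
    0 ≤ ∑ a, ∑ b, c a * c b * (∏ i, ‖A a i‖ ^ (-(2 * Δ))) *
      S (m a + m b) (Fin.append (fun i => EuclideanGeometry.inversion 0 1 (A a i)) (A b))

/-- **DECOMPOSITION filed** (`route edit --split MoebiusLimitOfTwoPointLaw --into {LimitExists, InversionUpgradeNormalised}`):
the glue is a landed theorem (p116785 + the proof of item 8367), in the `BernsteinTemperature` spelling of the parent. -/
theorem split_glue (hL : WeylWindow.LimitExists) (hI : HyperoctahedralRP.InversionUpgradeNormalised) :
    BernsteinTemperature.MoebiusLimitOfTwoPointLaw :=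
  Summit.CriticalPhenomena.Ising3DConformalLimit.PrecisionLaplacianMoebiusLimitOfTwoPointLaw.moebiusLimitOfTwoPointLaw_of_bare₂'
    hL Summit.CriticalPhenomena.Ising3DConformalLimit.Cruxes.RotationUpgradeFromTwoPoint.NullLaplacianEdgeGaussianity.RotationUpgradeFromTwoPoint_of hI

/-- … and it is EXACT under the route's own two-point item 0634 (p117654 + 8367): neither child is the crux
reworded, each is necessary. -/
theorem split_exact :
    BernsteinTemperature.MoebiusLimitOfTwoPointLaw ↔
      (IsingEuclidUpgrade.IsingEuclidUpgradeR2RotInvPowerLaw →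
        WeylWindow.LimitExists ∧ HyperoctahedralRP.InversionUpgradeNormalised) := by
  rw [Summit.CriticalPhenomena.Ising3DConformalLimit.PrecisionLaplacianMoebiusLimitOfTwoPointLaw.moebiusLimitOfTwoPointLaw_iff_bare₂']
  constructor
  · exact fun h hP => ⟨(h hP).1, (h hP).2.2⟩
  · exact fun h hP => ⟨(h hP).1,
      Summit.CriticalPhenomena.Ising3DConformalLimit.Cruxes.RotationUpgradeFromTwoPoint.NullLaplacianEdgeGaussianity.RotationUpgradeFromTwoPoint_of,
      (h hP).2⟩

end Summit.CriticalPhenomena.Ising3DConformalLimit.Cruxes.MoebiusLimitOfTwoPointLaw.StrategistCensus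

end
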